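import Mathlib
import Summits.Ventures.HodgeRepro.Tier4.Line1.RTFSetting
import Summits.Ventures.HodgeRepro.Tier4.Line1.KernelSupportFinite
import Summits.Ventures.HodgeRepro.Tier4.Line1.KernelUnfold

/-!
# Tier4/Line1/KernelOperator — LINE L1, J1 rung (0) `kernelOp` (DEFINED) and rung (1) `exists_kernelCLM`

Blind re-derivation cell `pub-hodge-repro`, Tier 4 «prove the step» (README §9–§10), seat t4-L1-p1 (prover, gen 0),
assignment t4-plan-1 S12278 (3) on LINE L1 (the RTF line): J1's rungs as typed in S12258 and folded into
Skeleton-v0.11.lean (L556–L592).  The def `kernelOp` and the statement `exists_kernelCLM` are restated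
BYTE-IDENTICALLY from Skeleton-v0.11.lean L558–L560 / L574–L578 inside `namespace
Summit.Ventures.HodgeRepro.Tier4.Line1.RTF.Setting` with `variable (S : Setting G)`; `kernelOp` lives here until
the lead names its served home (S12277 (b)).  Imports: the generic layer `RTFSetting`, `KernelSupportFinite` (for
`kernel_continuous`) and t4-L1-p3's `KernelUnfold` (for `isFiniteMeasure_restrict_DG`, reused by name).  No `sorry`;
axioms = the trio.

THE MATHEMATICS.  Write `ν := μ|_{DG}`, a finite measure (`DG ⊆ closure DG` compact, Haar measures are finite on
compacts).  The kernel `K_f` is continuous (`kernel_continuous`), hence bounded by some `M` on the compact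
`closure DG × closure DG`.  For `ψ ∈ L²(ν)` put `(T ψ)(x) := ∫ K_f(x, z) ψ(z) dν(z) = kernelOp f ψ x`:
* measurability: `(x, z) ↦ K_f(x, z) ψ(z)` is a.e.-strongly measurable for `ν ⊗ ν` (`K_f` continuous on `G × G`,
  Borel for a second countable `G`; `ψ` through `Prod.snd`), so `x ↦ ∫ … dν` is (`AEStronglyMeasurable.integral_prod_right'`);
* the bound: for `x ∈ DG`, `‖(T ψ)(x)‖ ≤ M ∫ ‖ψ‖ dν ≤ M ν(DG)^{1/2} ‖ψ‖₂` (`eLpNorm_le_eLpNorm_mul_rpow_measure_univ`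
  for `1 ≤ 2`), so `T ψ ∈ L²(ν)` (`MemLp.of_bound`) with `‖T ψ‖₂ ≤ M ν(DG) ‖ψ‖₂` (`eLpNorm_le_of_ae_bound`);
* linearity: the integrand is integrable for every `x` (`K_f(x, ·)` bounded on `DG`, `ψ ∈ L¹(ν)`), and `⇑(ψ₁ + ψ₂)`,
  `⇑(c • ψ)` agree a.e. with the pointwise operations, so `T` is linear on classes (`MemLp.toLp_eq_toLp_iff`);
* `T := LinearMap.mkContinuous`; `⇑(T ψ) =ᵐ kernelOp f ψ` is `MemLp.coeFn_toLp`.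

Nothing here says anything about the status of the Hodge conjecture for CM abelian varieties, which is NOT proved
(HC_CM is NOT proved by anyone in this repository).
-/

set_option autoImplicit false

noncomputable section

namespace Summit.Ventures.HodgeRepro.Tier4.Line1

open MeasureTheory Topology

namespace RTF

variable {G : Type} [Group G] [TopologicalSpace G] [IsTopologicalGroup G] [MeasurableSpace G]
  [BorelSpace G]

namespace Setting

variable (S : Setting G)

/-- (J1-(0), DEFINED object): **the integral operator of the kernel over the fundamental domain**,
`(K_f ψ)(x) = ∫_{DG} K_f(x, z) ψ(z) dz`. -/
def kernelOp (f ψ : G → ℂ) (x : G) : ℂ := ∫ z in S.DG, S.kernel f x z * ψ z ∂S.μ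

omit [BorelSpace G] in
/-- helper (proved): the kernel of a test function is bounded on `closure DG × closure DG` (continuity +
compactness). -/
theorem exists_kernel_bound {f : G → ℂ} (hf : IsTest f) :
    ∃ M : ℝ, 0 ≤ M ∧ ∀ x ∈ closure S.DG, ∀ z ∈ closure S.DG, ‖S.kernel f x z‖ ≤ M := by
  obtain ⟨C, hC⟩ := (S.compG.prod S.compG).exists_bound_of_continuousOn
    (S.kernel_continuous hf).continuousOn
  exact ⟨max C 0, le_max_right _ _, fun x hx z hz =>
    (show ‖S.kernel f x z‖ ≤ C from hC (x, z) ⟨hx, hz⟩).trans (le_max_left _ _)⟩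

/-- helper (proved): for every `x`, the integrand `z ↦ K_f(x, z) ψ(z)` is integrable on `DG` when `ψ` is
(`K_f(x, ·)` is continuous, hence bounded on the compact `closure DG`). -/
theorem integrable_kernel_mul {f : G → ℂ} (hf : IsTest f) {ψ : G → ℂ}
    (hψ : Integrable ψ (S.μ.restrict S.DG)) (x : G) :
    Integrable (fun z => S.kernel f x z * ψ z) (S.μ.restrict S.DG) := by
  have hcont : Continuous fun z => S.kernel f x z :=
    (S.kernel_continuous hf).comp (Continuous.prodMk_right x)
  obtain ⟨C, hC⟩ := S.compG.exists_bound_of_continuousOn hcont.continuousOn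
  refine hψ.bdd_mul (c := C) hcont.aestronglyMeasurable ?_
  filter_upwards [ae_restrict_mem₀ S.fdG.nullMeasurableSet] with z hz
  exact hC z (subset_closure hz)

/-- helper (proved): the kernel operator of an a.e.-strongly measurable function is a.e.-strongly measurable
(Fubini-type measurability of the parametric integral; `G` second countable so that `K_f` is Borel on `G × G`). -/
theorem kernelOp_aestronglyMeasurable [SecondCountableTopology G] {f : G → ℂ} (hf : IsTest f)
    {ψ : G → ℂ} (hψ : AEStronglyMeasurable ψ (S.μ.restrict S.DG)) :
    AEStronglyMeasurable (S.kernelOp f ψ) (S.μ.restrict S.DG) := by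
  haveI : IsFiniteMeasure (S.μ.restrict S.DG) := S.isFiniteMeasure_restrict_DG
  have hK : AEStronglyMeasurable (fun p : G × G => S.kernel f p.1 p.2)
      ((S.μ.restrict S.DG).prod (S.μ.restrict S.DG)) :=
    (S.kernel_continuous hf).aestronglyMeasurable
  have hψ' : AEStronglyMeasurable (fun p : G × G => ψ p.2)
      ((S.μ.restrict S.DG).prod (S.μ.restrict S.DG)) :=
    hψ.comp_quasiMeasurePreserving Measure.quasiMeasurePreserving_snd
  exact (hK.mul hψ').integral_prod_right'

omit [IsTopologicalGroup G] [BorelSpace G] in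
/-- helper (proved): the pointwise bound `‖(K_f ψ)(x)‖ ≤ M ∫ ‖ψ‖` on `closure DG`, `M` a bound of the kernel on
`closure DG × closure DG`. -/
theorem norm_kernelOp_le (f : G → ℂ) {M : ℝ}
    (hM : ∀ x ∈ closure S.DG, ∀ z ∈ closure S.DG, ‖S.kernel f x z‖ ≤ M) {ψ : G → ℂ}
    (hψ : Integrable ψ (S.μ.restrict S.DG)) {x : G} (hx : x ∈ closure S.DG) :
    ‖S.kernelOp f ψ x‖ ≤ M * ∫ z, ‖ψ z‖ ∂(S.μ.restrict S.DG) := by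
  unfold kernelOp
  refine (norm_integral_le_integral_norm _).trans ?_
  rw [← integral_const_mul]
  refine integral_mono_of_nonneg (Filter.Eventually.of_forall fun z => norm_nonneg _)
    (hψ.norm.const_mul M) ?_
  filter_upwards [ae_restrict_mem₀ S.fdG.nullMeasurableSet] with z hz
  rw [norm_mul]
  exact mul_le_mul_of_nonneg_right (hM x hx z (subset_closure hz)) (norm_nonneg _)

omit [IsTopologicalGroup G] [BorelSpace G] in
/-- helper (proved): `L¹ ≤ ν(univ)^{1/2} · L²` on the finite measure `ν = μ|_{DG}`. -/
theorem integral_norm_le_norm_Lp (ψ : Lp ℂ 2 (S.μ.restrict S.DG)) :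
    ∫ z, ‖ψ z‖ ∂(S.μ.restrict S.DG) ≤
      ((S.μ.restrict S.DG) Set.univ ^ (2⁻¹ : ℝ)).toReal * ‖ψ‖ := by
  haveI : IsFiniteMeasure (S.μ.restrict S.DG) := S.isFiniteMeasure_restrict_DG
  have h1 : ∫ z, ‖ψ z‖ ∂(S.μ.restrict S.DG) = (eLpNorm ψ 1 (S.μ.restrict S.DG)).toReal := by
    rw [integral_norm_eq_lintegral_enorm (Lp.aestronglyMeasurable ψ), eLpNorm_one_eq_lintegral_enorm]
  have h2 := eLpNorm_le_eLpNorm_mul_rpow_measure_univ (p := 1) (q := 2) one_le_two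
    (Lp.aestronglyMeasurable ψ)
  have h3 : (1 / (1 : ENNReal).toReal - 1 / (2 : ENNReal).toReal) = (2⁻¹ : ℝ) := by
    rw [ENNReal.toReal_one, ENNReal.toReal_ofNat]
    norm_num
  rw [h3] at h2
  have hfin : eLpNorm ψ 2 (S.μ.restrict S.DG) * (S.μ.restrict S.DG) Set.univ ^ (2⁻¹ : ℝ) ≠ ⊤ :=
    ENNReal.mul_ne_top (Lp.eLpNorm_ne_top ψ)
      (ENNReal.rpow_ne_top_of_nonneg (by norm_num) (measure_ne_top _ _))
  rw [h1, Lp.norm_def, mul_comm]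
  calc (eLpNorm ψ 1 (S.μ.restrict S.DG)).toReal
      ≤ (eLpNorm ψ 2 (S.μ.restrict S.DG) * (S.μ.restrict S.DG) Set.univ ^ (2⁻¹ : ℝ)).toReal :=
        ENNReal.toReal_mono hfin h2
    _ = (eLpNorm ψ 2 (S.μ.restrict S.DG)).toReal * ((S.μ.restrict S.DG) Set.univ ^ (2⁻¹ : ℝ)).toReal :=
        ENNReal.toReal_mul

/-- (J1-(1), prover-facing, M): **the kernel operator is a bounded operator on `L²(DG)`** (bounded by
`‖K_f‖_{L²(DG × DG)}` — `K_f` is bounded on the compact `closure DG × closure DG` by (0′), and `μ(DG) < ∞`). -/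
theorem exists_kernelCLM [SecondCountableTopology G] {f : G → ℂ} (hf : IsTest f) :
    ∃ T : Lp ℂ 2 (S.μ.restrict S.DG) →L[ℂ] Lp ℂ 2 (S.μ.restrict S.DG),
      ∀ ψ : Lp ℂ 2 (S.μ.restrict S.DG), ⇑(T ψ) =ᵐ[S.μ.restrict S.DG] S.kernelOp f ⇑ψ := by
  haveI : IsFiniteMeasure (S.μ.restrict S.DG) := S.isFiniteMeasure_restrict_DG
  obtain ⟨M, hM0, hM⟩ := S.exists_kernel_bound hf
  -- the constant `c = ν(univ)^{1/2}`
  set c : ℝ := ((S.μ.restrict S.DG) Set.univ ^ (2⁻¹ : ℝ)).toReal with hc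
  have hc0 : 0 ≤ c := ENNReal.toReal_nonneg
  -- the a.e. bound on `DG`
  have hbound : ∀ ψ : Lp ℂ 2 (S.μ.restrict S.DG),
      ∀ᵐ x ∂(S.μ.restrict S.DG), ‖S.kernelOp f ψ x‖ ≤ M * (c * ‖ψ‖) := by
    intro ψ
    filter_upwards [ae_restrict_mem₀ S.fdG.nullMeasurableSet] with x hx
    calc ‖S.kernelOp f ψ x‖
        ≤ M * ∫ z, ‖ψ z‖ ∂(S.μ.restrict S.DG) :=
          S.norm_kernelOp_le f hM ((Lp.memLp ψ).integrable one_le_two) (subset_closure hx)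
      _ ≤ M * (c * ‖ψ‖) := mul_le_mul_of_nonneg_left (S.integral_norm_le_norm_Lp ψ) hM0
  have hmem : ∀ ψ : Lp ℂ 2 (S.μ.restrict S.DG), MemLp (S.kernelOp f ψ) 2 (S.μ.restrict S.DG) :=
    fun ψ => MemLp.of_bound (S.kernelOp_aestronglyMeasurable hf (Lp.aestronglyMeasurable ψ)) _ (hbound ψ)
  -- the linear map on classes
  let Tlin : Lp ℂ 2 (S.μ.restrict S.DG) →ₗ[ℂ] Lp ℂ 2 (S.μ.restrict S.DG) :=
    { toFun := fun ψ => (hmem ψ).toLp _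
      map_add' := by
        intro ψ₁ ψ₂
        rw [← MemLp.toLp_add, MemLp.toLp_eq_toLp_iff]
        refine Filter.Eventually.of_forall fun x => ?_
        simp only [Pi.add_apply]
        unfold kernelOp
        rw [← integral_add (S.integrable_kernel_mul hf ((Lp.memLp ψ₁).integrable one_le_two) x)
          (S.integrable_kernel_mul hf ((Lp.memLp ψ₂).integrable one_le_two) x)]
        refine integral_congr_ae ?_
        filter_upwards [Lp.coeFn_add ψ₁ ψ₂] with z hz
        rw [hz, Pi.add_apply, mul_add]
      map_smul' := by
        intro a ψ
        rw [RingHom.id_apply, ← MemLp.toLp_const_smul, MemLp.toLp_eq_toLp_iff]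
        refine Filter.Eventually.of_forall fun x => ?_
        simp only [Pi.smul_apply, smul_eq_mul]
        unfold kernelOp
        rw [← integral_const_mul]
        refine integral_congr_ae ?_
        filter_upwards [Lp.coeFn_smul a ψ] with z hz
        rw [hz, Pi.smul_apply, smul_eq_mul]
        ring }
  -- the operator bound `‖T ψ‖₂ ≤ M c² ‖ψ‖₂`
  refine ⟨Tlin.mkContinuous (M * (c * c)) fun ψ => ?_, fun ψ => MemLp.coeFn_toLp (hmem ψ)⟩
  show ‖(hmem ψ).toLp _‖ ≤ M * (c * c) * ‖ψ‖
  rw [Lp.norm_toLp]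
  have h := eLpNorm_le_of_ae_bound (p := 2) (hbound ψ)
  have h2 : (2 : ENNReal).toReal⁻¹ = (2⁻¹ : ℝ) := by rw [ENNReal.toReal_ofNat]
  rw [h2] at h
  have hfin : (S.μ.restrict S.DG) Set.univ ^ (2⁻¹ : ℝ) * ENNReal.ofReal (M * (c * ‖ψ‖)) ≠ ⊤ :=
    ENNReal.mul_ne_top (ENNReal.rpow_ne_top_of_nonneg (by norm_num) (measure_ne_top _ _))
      ENNReal.ofReal_ne_top
  calc (eLpNorm (S.kernelOp f ψ) 2 (S.μ.restrict S.DG)).toReal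
      ≤ ((S.μ.restrict S.DG) Set.univ ^ (2⁻¹ : ℝ) * ENNReal.ofReal (M * (c * ‖ψ‖))).toReal :=
        ENNReal.toReal_mono hfin h
    _ = c * (M * (c * ‖ψ‖)) := by
        rw [ENNReal.toReal_mul, ENNReal.toReal_ofReal (mul_nonneg hM0 (mul_nonneg hc0 (norm_nonneg _)))]
    _ = M * (c * c) * ‖ψ‖ := by ring

end Setting

end RTF

end Summit.Ventures.HodgeRepro.Tier4.Line1
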